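/-
Origin: expansion seat `literature-prover-pub-hodgecm-cf-gaoullmo-g3-0`, handover v2 2026-08-18T05:18:44Z (`HOME/pub-hodgecm-cf-gaoullmo-g3/lean/CfGU3/GaoUllmoOrderFree.lean`, md5 44ab7e85, 74 lines);
landed by the gen-6 packager in gate run 23 as `HodgeCM/Literature/GaoUllmoOrderFree.lean` (verbatim).
-/
/-
Copyright (c) 2026. All rights reserved.
Released under Apache 2.0 license as described in the file LICENSE.
Origin: expansion seat `literature-prover-pub-hodgecm-cf-gaoullmo-g3-0` (unit pub-hodgecm-cf-gaoullmo-g3, CITED-FACT SEAT (4)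
Gao–Ullmo, generation 3).  Proposed place: `HodgeCM/Proofs/Pohlmann/GaoUllmoOrderFree.lean`
(module `HodgeCM.Proofs.Pohlmann.GaoUllmoOrderFree`).  Imports: landed run-22 modules only.
-/
import Summits.HodgeConjecture.HodgeCM.Proofs.Pohlmann.GaoUllmoCrossModel

/-!
# The Gao–Ullmo dictionary and the cross-model identity without the ordering convention

Gao–Ullmo, *Hodge cycles and quadratic relations between holomorphic periods on CM abelian varieties*, J. Inst. Math.
Jussieu 25 (2025) 215–249 = arXiv:2411.12249, §3.1 fixes "an ordering on `S` such that `φ ≤ φ'` for each `φ ∈ Φ` and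
`φ' ∈ Φ̄`" before stating Theorem 3.1 (Pohlmann); the typed statements `GaoUllmo.Theorem31` / `Theorem31_finrank`
(`Literature/GaoUllmo.lean`) carry this convention verbatim as the hypothesis `OrderConvention Φ`, and so do their
package-vocabulary readings `GaoUllmo.finrank_Bp_pi_eq_card_hodgeWeight` (`Proofs/Pohlmann/GaoUllmoDictionary.lean`) and
`Universe.finrank_hodgeClassesOf_eq_finrank_Bp` (`Proofs/Pohlmann/GaoUllmoCrossModel.lean`).

The convention only fixes the SIGN of each basis vector `[P] = ⋀_{φ ∈ P} φ`; spans and dimensions do not see it.  The kernel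
theorem `GaoUllmo.finrank_Bp_eq_card` (`Literature/GaoUllmoTheorem31.lean`, cf-gaoullmo gen 1, delta v5.1) gives
`dim_ℚ B^p(A) = #{P : |P| = 2p, (3.2)}` for ANY linear order on `S = Hom(E, ℂ)`.  This file records the two corollaries
in package vocabulary with the hypothesis `hord : OrderConvention (piCMType Θ)` DROPPED (any `LinearOrder` instance on
`Hom(F^{n+1}, ℂ)`; one is still needed to define `[P]`, hence `H^{p,p}` and `B^p`):

* `GaoUllmo.finrank_Bp_pi_eq_card_hodgeWeight'` — `dim_ℚ B^p(A_{(F^{n+1}, ⊔_j Θ_j)}) = #{S // IsHodgeWeight Θ p S}`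
  (`F` Galois CM; nothing else);
* `Universe.finrank_hodgeClassesOf_eq_finrank_Bp'` — the cross-model identity
  `dim_ℚ Hdg^p(∏_j A_{(F,Θ_j)}) (universe `U`, `ModelAxioms` + N1–N4, `p ≥ 1`) = dim_ℚ B^p (Gao–Ullmo's model)`.

Nothing is cited or posited here; kernel corollaries of landed theorems (standard axioms only).
-/

noncomputable section

namespace HodgeCM

namespace GaoUllmo

open Literature.AlgebraicGeometry.Motives (CMType)

variable {F : Type} [Field F] [NumberField F] {n : ℕ}

/-- **Gao–Ullmo Thm 3.1 "In particular", package vocabulary, no ordering convention** (kernel): for `F` a Galois CM field and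
ANY linear order on `Hom(F^{n+1}, ℂ)`, `dim_ℚ B^p(A_{(F^{n+1}, ⊔_j Θ_j)})` is the number of Hodge weights `S` of the package
(`IsHodgeWeight Θ p S`).  From `finrank_Bp_eq_card` (gen 1, v5.1) and `card_hodgeWeight_eq` (gen 2). -/
theorem finrank_Bp_pi_eq_card_hodgeWeight' [NumberField.IsCMField F] [IsGalois ℚ F]
    [LinearOrder (Emb (Fin (n + 1) → F))] (Θ : Fin (n + 1) → CMType F) (p : ℕ) :
    Module.finrank ℚ (Bp (piCMType Θ) p) = Nat.card {S : Fin (n + 1) → Finset (F →+* ℂ) // IsHodgeWeight Θ p S} := by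
  rw [finrank_Bp_eq_card (isCMAlgebra_pi (Fin (n + 1)) F) (piCMType Θ) p, card_hodgeWeight_eq]

end GaoUllmo

namespace Universe

open Literature.AlgebraicGeometry.Motives (CMType)
open HodgeCM.GaoUllmo

variable {U : Universe}

/-- **Cross-model consistency, no ordering convention** (kernel): for a Galois CM field `F`, CM types `Θ_0, …, Θ_n`, `p ≥ 1`
and ANY linear order on `Hom(F^{n+1}, ℂ)`, the `ℚ`-dimension of the Hodge classes of `∏_j A_{(F,Θ_j)}` in the geometric
universe (`ModelAxioms` + N1–N4) equals `dim_ℚ B^p` in Gao–Ullmo's model of `A_{(F^{n+1}, ⊔_j Θ_j)}`. -/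
theorem finrank_hodgeClassesOf_eq_finrank_Bp' (M : U.ModelAxioms) (hN1 : U.Fact_cupExterior) (hN2 : U.Fact_cup_hodge)
    (hN3 : U.Fact_pull_H0) (hN4 : U.Fact_hodge_F0) (F : CMField) [IsGalois ℚ F] {n : ℕ} (Θ : Fin (n + 1) → CMType F)
    [LinearOrder (Emb (Fin (n + 1) → (F : Type)))] {p : ℕ} (hp : 0 < p) :
    Module.finrank ℚ (U.hodgeClassesOf (U.cmProd F Θ) p) = Module.finrank ℚ (Bp (piCMType Θ) p) := by
  rw [finrank_hodgeClassesOf (F := F) (n := n) (Θ := Θ) M hN1 hN2 hN3 hN4 hp, finrank_Bp_pi_eq_card_hodgeWeight' Θ p]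

end Universe

end HodgeCM

end
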